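import Summits.HodgeConjecture.HodgeConjecture.Theorems.VHCAbelianSchemesRoadIsogenyDerivedAdjointPairIdentity
import HarnessLib

/-!
# Road №4 (`VHCAbelianSchemesRoad`) — law (δ) `AdjTriangleOfSESδComp` HOLDS for the degree-one pair (costume check of the fourth law of
# the node «`IsogenyDerivedAdjointPair`», crux stmt-HodgeConjecture-26512)

research route conditional on HC_CM; not a corollary; Q11.4-sentence-2 already refuted in dim ≥ 3.

Seat core-w4. `--supports stmt-HodgeConjecture-26512 --as helper`; closes NO stub or item; HC_CM HELD. The node's fourth law
`IsogenyDerivedAdjointPair.AdjTriangleOfSESδComp` (p650519; core-w3's (iv): naturality of `adj` in the first variable along the connecting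
morphisms `DerivedCategory.triangleOfSESδ`, the hypothesis `hδ` of the (At)Pair reduction) is PROVED for the degree-one pair `pairOfEqId A g hg`
(`Hom.toSchemeHom g = 𝟙`; p651433): Mathlib's `DerivedCategory.triangleOfSESδ_naturality` along the morphism of short complexes
`ι⁻¹ : S ⟶ g^*•S`, then the naturality of `shiftFunctorAdd'`. With `…Identity.lean` this certifies that ALL FOUR laws route K must discharge
are consistently oriented. Nothing here says the node is inhabited for `deg g ≥ 2`, nor (AtPair), (c1), T′ or HC_CM; typed ≠ proved.

References: [cite: Weibel1994, §10.2 (connecting morphism) and §10.4] [cite: GortzWedhorn2023, Prop. F.191].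
-/

noncomputable section

-- `TopCat.Presheaf`/`Scheme.Modules` are not reducible (as in Mathlib's `AlgebraicGeometry/Modules/Sheaf.lean`).
set_option backward.isDefEq.respectTransparency false

open CategoryTheory CategoryTheory.Category CategoryTheory.Limits AlgebraicGeometry Opposite
open DerivedCategory

namespace Summit.HodgeConjecture.HodgeConjecture.Ring2.SemiregularRepresentatives

set_option linter.dupNamespace false -- the cell's namespace repeats the summit name, as in every `Ring2*` file

open Literature.AlgebraicGeometry Literature.AlgebraicGeometry.Modules Literature.AlgebraicGeometry.Motives
open Literature.AlgebraicGeometry.Motives.AbelianVariety Literature.AlgebraicGeometry.KTheory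

universe w

variable (A : AbelianVariety ℂ) (g : A ⟶ A) (hg : Hom.toSchemeHom g = 𝟙 A.X.left) [HasDerivedCategory.{w} A.X.left.Modules]

/-- **Law (δ) holds for the degree-one pair** (`(pairOfEqId A g hg).AdjTriangleOfSESδComp`): `adj (δ_{g^*•S} · w) = δ_S · adj w` —
Mathlib's `DerivedCategory.triangleOfSESδ_naturality` along `ι⁻¹ : S ⟶ g^*•S` (componentwise `(pullbackComplexIsoOfEqId' …).inv`, a morphism
of short complexes by `pullbackComplexIsoOfEqId'_inv_naturality`), then the naturality of `shiftFunctorAdd'`.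
[cite: Weibel1994, §10.2 and §10.4] [cite: GortzWedhorn2023, Prop. F.191] -/
theorem pairOfEqId_adjTriangleOfSESδComp : (pairOfEqId A g hg).AdjTriangleOfSESδComp := by
  intro S hS hS' h₁ h₃ L hL n m h w
  change adjOfEqId A g hg _ L m _ = ShiftedHom.comp _ (adjOfEqId A g hg _ L n w) h
  have hnat := DerivedCategory.triangleOfSESδ_naturality hS hS'
    (ShortComplex.homMk (pullbackComplexIsoOfEqId' A g hg S.X₁).inv (pullbackComplexIsoOfEqId' A g hg S.X₂).inv
      (pullbackComplexIsoOfEqId' A g hg S.X₃).inv (pullbackComplexIsoOfEqId'_inv_naturality A g hg S.f)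
      (pullbackComplexIsoOfEqId'_inv_naturality A g hg S.g))
  simp only [ShortComplex.homMk_τ₁, ShortComplex.homMk_τ₃] at hnat
  simp only [adjOfEqId_apply, ShiftedHom.comp, Functor.map_comp, Category.assoc]
  have hadd := (shiftFunctorAdd' (DerivedCategory A.X.left.Modules) n 1 m h).inv.naturality
    (Q.map (pushforwardComplexIsoOfEqId' A g hg L).inv)
  simp only [Functor.comp_map] at hadd
  rw [hadd, ← reassoc_of% hnat]

/-- **Law (δ) for the identity pair.** [cite: Weibel1994, §10.2 and §10.4] -/
theorem identityPair_adjTriangleOfSESδComp : (identityPair A).AdjTriangleOfSESδComp :=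
  pairOfEqId_adjTriangleOfSESδComp A (𝟙 A) (toSchemeHom_id A)

end Summit.HodgeConjecture.HodgeConjecture.Ring2.SemiregularRepresentatives

end
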